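import Literature.Computability.AlgebraicComplexity.MaxEntropyGivenMarginals
import HarnessLib

/-!
# Entropies and the penalty term in nats: the shapes a log-linear certificate consumes

Topic `Literature/Computability/AlgebraicComplexity`.  The exponents of the laser method with
asymmetric hashing (Vassilevska Williams–Xu–Xu–Zhou 2024, Prop. 5.1 / Thm. 5.3 / Prop. 6.2: `E_r`,
`P_α`, `λ_Z`; the tree's `RegionDatum.exponent`, `maxEntropyGivenMarginals`, `targetLambda`) are
built from Shannon entropies in bits, `shannonEntropy P = (∑ −P ln P)/ln 2`
(`QuantumFunctionals.lean`), and from `max_{α'∈D} H(α')` (`MaxEntropyGivenMarginals.lean`).  A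
numerical certificate (`LogLinearCertificate.lean`) bounds linear combinations of `ln(a/d)` and of
entropy sums `∑ −pᵢ ln pᵢ` of RATIONAL vectors.  This file PROVES the two identities/inequalities
that put the former in the latter shape (multiply through by `ln 2 > 0`):

* `log_two_mul_shannonEntropy` — `ln 2 · H(P) = ∑_x −P(x) ln P(x)`;
* `log_two_mul_maxEntropyGivenMarginals_le_prodForm` — **the product-form Gibbs bound**: for a
  distribution `α` supported in `Φ` and ANY positive weights `x_i, y_j, z_k`,
  `ln 2 · max_{α'∈D(α)} H(α') ≤ ln(∑_{(i,j,k)∈Φ} x_i y_j z_k) − ∑_i α_X(i) ln x_i − ∑_j α_Y(j) ln y_j − ∑_k α_Z(k) ln z_k`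
  (`maxEntropyGivenMarginals_le_entropyDual` at the multipliers `λ = ln x, ln y, ln z`; with rational
  weights every term is a logarithm of a rational — no exponentials — and the bound is tight at the
  exponentials of the true Lagrange multipliers, §8 "Lagrange multipliers");
  `log_two_mul_maxEntropyPenalty_le_prodForm` — the same for `P_α = max H − H(α)`.

No definitions, no named facts.

## References

* V. Vassilevska Williams, Y. Xu, Z. Xu, R. Zhou, *New bounds for matrix multiplication: from alpha
  to omega*, SODA 2024, arXiv:2307.07970, §3.9 (entropy), §5 (`P_α`), §8 ("Lagrange multipliers":
  the program encodes `α_max` by `exp(λ_X(i)+λ_Y(j)+λ_Z(k)+λ_S−1) = α_max(i,j,k)`).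
  [VassilevskaWilliamsXuXuZhou2024]
-/

noncomputable section

open scoped BigOperators
open Real (negMulLog)

namespace Literature.Computability.AlgebraicComplexity

variable {ι κ μ : Type*} [Fintype ι] [Fintype κ] [Fintype μ]

/-- `ln 2 · H(P) = ∑_x −P(x) ln P(x)` (entropy in nats). [cite: VassilevskaWilliamsXuXuZhou2024, §3.9] -/
theorem log_two_mul_shannonEntropy {α : Type*} [Fintype α] (P : α → ℝ) :
    Real.log 2 * shannonEntropy P = ∑ x, negMulLog (P x) := by
  rw [shannonEntropy_def, mul_div_cancel₀ _ (ne_of_gt (Real.log_pos one_lt_two))]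

/-- **Product-form Gibbs bound for the maximum entropy with given marginals, in nats**: for a
distribution `α` supported in `Φ` and positive weights `x, y, z`,
`ln 2 · max_{α'∈D(α)} H(α') ≤ ln(∑_{Φ} x_i y_j z_k) − ∑_i α_X(i) ln x_i − ∑_j α_Y(j) ln y_j − ∑_k α_Z(k) ln z_k`.
[cite: VassilevskaWilliamsXuXuZhou2024, §8 (Lagrange multipliers, exponential form)] -/
theorem log_two_mul_maxEntropyGivenMarginals_le_prodForm {Φ : Finset (ι × κ × μ)} {α : ι × κ × μ → ℝ}
    (hα : α ∈ stdSimplex ℝ (ι × κ × μ)) (hΦ : ∀ s, s ∉ Φ → α s = 0)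
    (x : ι → ℝ) (y : κ → ℝ) (z : μ → ℝ) (hx : ∀ i, 0 < x i) (hy : ∀ j, 0 < y j) (hz : ∀ k, 0 < z k) :
    Real.log 2 * maxEntropyGivenMarginals Φ α ≤
      Real.log (∑ s ∈ Φ, x s.1 * y s.2.1 * z s.2.2) -
        (∑ i, marginalDist₁ α i * Real.log (x i) + ∑ j, marginalDist₂ α j * Real.log (y j) +
          ∑ k, marginalDist₃ α k * Real.log (z k)) := by
  have h := maxEntropyGivenMarginals_le_entropyDual hα hΦ (fun i => Real.log (x i))
    (fun j => Real.log (y j)) (fun k => Real.log (z k))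
  have h2 : (0 : ℝ) < Real.log 2 := Real.log_pos one_lt_two
  unfold entropyDual at h
  rw [le_div_iff₀ h2] at h
  have hsum : ∑ s ∈ Φ, Real.exp (Real.log (x s.1) + Real.log (y s.2.1) + Real.log (z s.2.2)) =
      ∑ s ∈ Φ, x s.1 * y s.2.1 * z s.2.2 := by
    refine Finset.sum_congr rfl fun s _ => ?_
    rw [Real.exp_add, Real.exp_add, Real.exp_log (hx _), Real.exp_log (hy _), Real.exp_log (hz _)]
  rw [hsum] at h
  linarith

/-- **The penalty term in nats, product form**: `ln 2 · P_α ≤ [the bound above] − ∑ −α ln α`.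
[cite: VassilevskaWilliamsXuXuZhou2024, §5 (P_α) and §8] -/
theorem log_two_mul_maxEntropyPenalty_le_prodForm {Φ : Finset (ι × κ × μ)} {α : ι × κ × μ → ℝ}
    (hα : α ∈ stdSimplex ℝ (ι × κ × μ)) (hΦ : ∀ s, s ∉ Φ → α s = 0)
    (x : ι → ℝ) (y : κ → ℝ) (z : μ → ℝ) (hx : ∀ i, 0 < x i) (hy : ∀ j, 0 < y j) (hz : ∀ k, 0 < z k) :
    Real.log 2 * maxEntropyPenalty Φ α ≤
      Real.log (∑ s ∈ Φ, x s.1 * y s.2.1 * z s.2.2) -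
        (∑ i, marginalDist₁ α i * Real.log (x i) + ∑ j, marginalDist₂ α j * Real.log (y j) +
          ∑ k, marginalDist₃ α k * Real.log (z k)) - ∑ s, negMulLog (α s) := by
  have h := log_two_mul_maxEntropyGivenMarginals_le_prodForm hα hΦ x y z hx hy hz
  rw [maxEntropyPenalty, mul_sub, log_two_mul_shannonEntropy]
  linarith

end Literature.Computability.AlgebraicComplexity

end
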